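import Summits.CriticalPhenomena.PercolationContinuityZ3.Theorems.Transplant.SkelNegBParamsRootArith
import HarnessLib

/-!
# N1 params, chain of record `NegB`, part RootArith-A — the (ζ′) twin of part RootArith: THE INTEGER ARITHMETIC OF THE ROOT RUN'S FINE READINGS AT A
# GENERIC EVEN LATTICE CONSTANT `A` (the chain takes `A := Aof κ = 20K`) with the box multiplier `Q` (the chain takes `Q := Kq`): reading unit `u`
# (= `s₀`, one stride = one period = `u` fine cells; `c₀ = A·u`), `D = A²·m`, the run ends at the next cell centre `20r₀ = 800·Q·u` with arrival
# half-width `b0TA₀ − 1 = 10·Q·u − 1`, `N + 1 ≤ 1000·Q` strides, floors `2000·Q·(RA′+2) ≤ n_L`, `22000·Q·(RA′+2) ≤ ℓ_L`.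
The reductions: `(A·u·(A·Λ) + A²m/2)/(A²m) = (2uΛ + m)/(2m)` (**`coarse_cancel`** — `A` cancels exactly), the along increment
`G := (A·u·(A·X/n))/(A²m)` with **`incr_boundsA : m·n·G ≤ u·X ∧ u·X − u·n − m·n ≤ m·n·G`** (`A ≥ 1`; `A`-free), the transverse term
`(A·u·(A·Y))/(A²m) = (u·Y)/m` (**`trans_cancel`**). RESULTS in the literal shapes of p3's (ζ′) residue hypotheses after `c₀ = A·u₀A`, `D_A = A²·m`,
`lam0 A … = A·Λ₀`: **`along_posA` / `along_negA`** (last core in `800Qu ± (10Qu − 1)` from the centring `|F + σu(N+1) − σ·800Qu| ≤ u`), **`trans_lastA`**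
(across: `±(10Qu − 1)` from `|Λ₁| ≤ 2m`).  (stmt-g16 2026-08-22; NEG-SCOPE §B.19 (ζ′).)
builds on p205010 (kernel theorem, internal audit signed; external expert review pending) — nothing in this file uses p205010; NOTHING is claimed about
the node `SamePDropOfSkeletonNeg₁` (OPEN).  Pure arithmetic; no definitions.
Lane `prim-bschramm-*`, seat `prim-bschramm-stmt` (gen 16); helper file (`--supports stmt-CriticalPhenomena-4575 --as helper`); ledger HOME/prim-bschramm-stmt/NEG-PARAMS.md.
[cite: KozmaNitzan2024, §4 p. 28 ((32) at the root), Lemma 11 (p. 22: the target boxes)] [cite: MartineauTassion2017, §4.3 Lemma 4.2]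
-/

namespace Summit.CriticalPhenomena.PercolationContinuityZ3.Theorems.Transplant

namespace PlanarSkeletonNeg

namespace NegB

namespace RootArithA

open RootArith (floor_sandwich B_bounds)

/-- **The lattice constant cancels in the fine reading**: for even `A > 0`: `(A·u·(A·Λ) + A²m/2)/(A²m) = (2uΛ + m)/(2m)`. [folklore] -/
theorem coarse_cancel {A u m Λ : ℤ} (hA : 0 < A) (hAe : 2 ∣ A) :
    (A * u * (A * Λ) + A ^ 2 * m / 2) / (A ^ 2 * m) = (2 * u * Λ + m) / (2 * m) := by
  obtain ⟨a, ha⟩ := hAe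
  have ha0 : 0 < a := by linarith
  have e1 : A ^ 2 * m / 2 = 2 * a * a * m := by
    rw [ha, show (2 * a) ^ 2 * m = (2 * a * a * m) * 2 by ring, Int.mul_ediv_cancel _ (by norm_num)]
  have e2 : A * u * (A * Λ) + 2 * a * a * m = (2 * a * a) * (2 * u * Λ + m) := by rw [ha]; ring
  have e3 : A ^ 2 * m = (2 * a * a) * (2 * m) := by rw [ha]; ring
  rw [e1, e2, e3, Int.mul_ediv_mul_of_pos _ _ (by positivity)]

/-- The run origin's fine coordinate `F := (A·u·(A·Λ) + A²m/2)/(A²m)` (`A` even): `2mF ≤ 2uΛ + m < 2mF + 2m`. [folklore] -/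
theorem coarse_boundsA {A u m Λ : ℤ} (hA : 0 < A) (hAe : 2 ∣ A) (hm : 0 < m) :
    2 * m * ((A * u * (A * Λ) + A ^ 2 * m / 2) / (A ^ 2 * m)) ≤ 2 * u * Λ + m ∧
      2 * u * Λ + m < 2 * m * ((A * u * (A * Λ) + A ^ 2 * m / 2) / (A ^ 2 * m)) + 2 * m := by
  rw [coarse_cancel (u := u) (m := m) (Λ := Λ) hA hAe]
  exact floor_sandwich (by linarith)

/-- **The along increment** `G := (A·u·(A·X/n))/(A²m)` (`A ≥ 1`, `u ≥ 0`): `m·n·G ≤ u·X` and `u·X − u·n − m·n ≤ m·n·G` (`A`-free). [folklore] -/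
theorem incr_boundsA {A u m n X : ℤ} (hA : 1 ≤ A) (hu : 0 ≤ u) (hm : 0 < m) (hn : 0 < n) :
    m * n * ((A * u * (A * X / n)) / (A ^ 2 * m)) ≤ u * X ∧ u * X - u * n - m * n ≤ m * n * ((A * u * (A * X / n)) / (A ^ 2 * m)) := by
  have hA0 : 0 < A := by linarith
  have hAm : 0 < A * m := mul_pos hA0 hm
  rw [show A * u * (A * X / n) = A * (u * (A * X / n)) by ring, show A ^ 2 * m = A * (A * m) by ring, Int.mul_ediv_mul_of_pos _ _ hA0]
  obtain ⟨i1, i2⟩ := floor_sandwich (x := A * X) hn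
  set I := A * X / n
  obtain ⟨g1, g2⟩ := floor_sandwich (x := u * I) hAm
  set G := u * I / (A * m)
  constructor
  · have h1 : n * (A * m * G) ≤ n * (u * I) := mul_le_mul_of_nonneg_left g1 hn.le
    have h2 : u * (n * I) ≤ u * (A * X) := mul_le_mul_of_nonneg_left i1 hu
    have h3 : A * (m * n * G) ≤ A * (u * X) := by linarith
    exact le_of_mul_le_mul_left h3 hA0
  · have h1 : u * (A * X) ≤ u * (n * I + n) := mul_le_mul_of_nonneg_left i2.le hu
    have h2 : n * (u * I) ≤ n * (A * m * G + A * m) := mul_le_mul_of_nonneg_left g2.le hn.le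
    have key : A * (u * X - m * n - m * n * G) ≤ u * n := by linarith
    have hun : 0 ≤ u * n := mul_nonneg hu hn.le
    rcases le_or_gt (u * X - m * n - m * n * G) 0 with h | h
    · linarith
    · have h3 : 1 * (u * X - m * n - m * n * G) ≤ A * (u * X - m * n - m * n * G) := mul_le_mul_of_nonneg_right hA h.le
      linarith

/-- **The transverse term**: `(A·u·(A·Y))/(A²m) = (u·Y)/m` (`A > 0`). [folklore] -/
theorem trans_cancel {A u m Y : ℤ} (hA : 0 < A) : (A * u * (A * Y)) / (A ^ 2 * m) = (u * Y) / m := by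
  rw [show A * u * (A * Y) = A ^ 2 * (u * Y) by ring, Int.mul_ediv_mul_of_pos _ _ (by positivity)]

/-- `H := (A·u·(A·Y))/(A²m)`: `mH ≤ uY < mH + m`. [folklore] -/
theorem trans_boundsA {A u m Y : ℤ} (hA : 0 < A) (hm : 0 < m) :
    m * ((A * u * (A * Y)) / (A ^ 2 * m)) ≤ u * Y ∧ u * Y < m * ((A * u * (A * Y)) / (A ^ 2 * m)) + m := by
  rw [trans_cancel hA]; exact floor_sandwich hm

/-- **ALONG, `σ = 1`** ((ζ′) twin of `RootArith.along_pos`): the last core's fine reading lands in `[800Qu − 10Qu + 1, 800Qu + 10Qu − 1] =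
[20r₀ − b0TA₀ + 1, 20r₀ + b0TA₀ − 1]`. [cite: KozmaNitzan2024, §4 Lemma 11 (p. 22)] -/
theorem along_posA {A Q u m n su v ℓ W RA q N Λ : ℤ} (hA : 2 ≤ A) (hQ : 1 ≤ Q) (hu : 1 ≤ u) (hn : 1 ≤ n) (hm : n * (ℓ - 1) < m)
    (hsu : n ≤ su) (hsu' : su ≤ 11 * n) (hv : |v| ≤ n) (hW : su * W ≤ n * ℓ + su) (hW0 : 0 ≤ W) (hRA : 0 ≤ RA)
    (hRAn : 2000 * Q * (RA + 2) ≤ n) (hRAℓ : 22000 * Q * (RA + 2) ≤ ℓ) (hq : 0 ≤ q) (hq' : 4 * q ≤ n) (hN : 0 ≤ N) (hN' : N + 1 ≤ 1000 * Q)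
    (hcen : |(A * u * (A * Λ) + A ^ 2 * m / 2) / (A ^ 2 * m) + u * (N + 1) - 800 * Q * u| ≤ u) :
    800 * Q * u - 10 * Q * u + 1 ≤ (A * u * (A * Λ) + A ^ 2 * m / 2) / (A ^ 2 * m) +
        (A * u * (A * (m * (min (1 * ((N + 1) * n - q - (N + 1) * RA)) (1 * ((N + 1) * n + q + (N + 1) * RA))) -
          max (v * (su * (min (1 * (-(W + (N + 1) * RA))) (1 * (W + (N + 1) * RA)) - 1))) (v * (su * (max (1 * (-(W + (N + 1) * RA))) (1 * (W + (N + 1) * RA))) + su - 1))) / n)) /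
          (A ^ 2 * m) ∧
      (A * u * (A * Λ) + A ^ 2 * m / 2) / (A ^ 2 * m) +
        (A * u * (A * (m * (max (1 * ((N + 1) * n - q - (N + 1) * RA)) (1 * ((N + 1) * n + q + (N + 1) * RA))) -
          min (v * (su * (min (1 * (-(W + (N + 1) * RA))) (1 * (W + (N + 1) * RA)) - 1))) (v * (su * (max (1 * (-(W + (N + 1) * RA))) (1 * (W + (N + 1) * RA))) + su - 1))) / n)) /
          (A ^ 2 * m) + 1 ≤ 800 * Q * u + 10 * Q * u - 1 := by
  have hn0 : 0 < n := by linarith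
  have hu0 : 0 ≤ u := by linarith
  have hQRA : 0 ≤ Q * RA := mul_nonneg (by linarith) hRA
  have hℓ1 : 47 ≤ ℓ := by linarith
  have hm0 : 0 < m := by have : 0 ≤ n * (ℓ - 1) := mul_nonneg hn0.le (by linarith); linarith
  have hm2 : 2 ≤ m := by have : (1 : ℤ) * 46 ≤ n * (ℓ - 1) := mul_le_mul hn (by linarith) (by norm_num) hn0.le; linarith
  have hQu : u ≤ Q * u := le_mul_of_one_le_left hu0 hQ
  set Fc := (A * u * (A * Λ) + A ^ 2 * m / 2) / (A ^ 2 * m)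
  set L := W + (N + 1) * RA with hLdef
  have hNR : 0 ≤ (N + 1) * RA := mul_nonneg (by linarith) hRA
  have hL0 : 0 ≤ L := by rw [hLdef]; linarith
  have hNR' : (N + 1) * RA ≤ 1000 * Q * RA := mul_le_mul_of_nonneg_right hN' hRA
  have hqr : 4 * (q + (N + 1) * RA) ≤ 3 * n := by linarith
  simp only [one_mul]
  rw [min_eq_left (by linarith : (N + 1) * n - q - (N + 1) * RA ≤ (N + 1) * n + q + (N + 1) * RA),
    max_eq_right (by linarith : (N + 1) * n - q - (N + 1) * RA ≤ (N + 1) * n + q + (N + 1) * RA),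
    min_eq_left (by linarith : -L ≤ L), max_eq_right (by linarith : -L ≤ L)]
  obtain ⟨hBmax, hBmin⟩ := B_bounds (v := v) (su := su) (L := L) (by linarith) hL0
  set Bmax := max (v * (su * (-L - 1))) (v * (su * L + su - 1))
  set Bmin := min (v * (su * (-L - 1))) (v * (su * L + su - 1))
  have hℓ0 : 0 ≤ ℓ := by linarith
  have hsu0 : 0 ≤ su := by linarith
  have hsuL : su * (L + 1) ≤ n * ℓ + 22 * n + 11000 * Q * n * RA := by
    have h1 : su * ((N + 1) * RA) ≤ (11 * n) * (1000 * Q * RA) := mul_le_mul hsu' hNR' hNR (by positivity)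
    rw [hLdef]; linarith
  have hvs : |v| * (su * (L + 1)) ≤ n * (n * ℓ + 22 * n + 11000 * Q * n * RA) :=
    mul_le_mul hv hsuL (by positivity) (by positivity)
  have h3m : 2 * (n * (n * ℓ + 22 * n + 11000 * Q * n * RA)) ≤ 3 * m * n := by
    have hℓ' : 47 + 22000 * Q * RA ≤ ℓ := by linarith
    have h1 := mul_le_mul_of_nonneg_left hℓ' hn0.le
    have h2X : 2 * (n * ℓ + 22 * n + 11000 * Q * n * RA) ≤ 3 * m := by linarith
    have h3 := mul_le_mul_of_nonneg_left h2X hn0.le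
    linarith
  have hBx : 2 * |Bmax| ≤ 3 * m * n := by linarith
  have hBn : 2 * |Bmin| ≤ 3 * m * n := by linarith
  have hcen' := abs_le.1 hcen
  constructor
  · obtain ⟨-, g2⟩ := incr_boundsA (A := A) (u := u) (m := m) (n := n) (X := m * ((N + 1) * n - q - (N + 1) * RA) - Bmax) (by linarith) hu0 hm0 hn0
    set G := A * u * (A * (m * ((N + 1) * n - q - (N + 1) * RA) - Bmax) / n) / (A ^ 2 * m)
    have e1 : u * (4 * (m * ((N + 1) * n - q - (N + 1) * RA))) ≥ u * (4 * m * n * (N + 1) - 3 * m * n) := by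
      refine mul_le_mul_of_nonneg_left ?_ hu0
      have := mul_le_mul_of_nonneg_left hqr hm0.le
      linarith
    have e2 : 2 * (u * Bmax) ≤ 3 * u * m * n := by
      have h1 : u * Bmax ≤ u * |Bmax| := mul_le_mul_of_nonneg_left (le_abs_self _) hu0
      have h2 := mul_le_mul_of_nonneg_left hBx hu0
      linarith
    have key : 4 * (m * n * (G - u * (N + 1) + 3 * u + 1)) ≥ u * n * (3 * m - 4) := by linarith
    have hX : 0 ≤ G - u * (N + 1) + 3 * u + 1 := by
      by_contra hc
      push Not at hc
      have h1 : 4 * (m * n) * (G - u * (N + 1) + 3 * u + 1) ≤ 4 * (m * n) * (-1) := mul_le_mul_of_nonneg_left (by linarith) (by positivity)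
      have h2 : 0 ≤ u * n * (3 * m - 4) := mul_nonneg (mul_nonneg hu0 hn0.le) (by linarith)
      have hmn : 0 < m * n := mul_pos hm0 hn0
      linarith
    linarith
  · obtain ⟨g1, -⟩ := incr_boundsA (A := A) (u := u) (m := m) (n := n) (X := m * ((N + 1) * n + q + (N + 1) * RA) - Bmin) (by linarith) hu0 hm0 hn0
    set G := A * u * (A * (m * ((N + 1) * n + q + (N + 1) * RA) - Bmin) / n) / (A ^ 2 * m)
    have e1 : u * (4 * (m * ((N + 1) * n + q + (N + 1) * RA))) ≤ u * (4 * m * n * (N + 1) + 3 * m * n) := by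
      refine mul_le_mul_of_nonneg_left ?_ hu0
      have := mul_le_mul_of_nonneg_left hqr hm0.le
      linarith
    have e2 : 2 * (u * (-Bmin)) ≤ 3 * u * m * n := by
      have h1 : u * (-Bmin) ≤ u * |Bmin| := mul_le_mul_of_nonneg_left (neg_le_abs _) hu0
      have h2 := mul_le_mul_of_nonneg_left hBn hu0
      linarith
    have key : 4 * (m * n * G) ≤ 4 * u * m * n * (N + 1) + 9 * u * m * n := by linarith
    have hX : G ≤ u * (N + 1) + 3 * u - 1 := by
      by_contra hc
      push Not at hc
      have h1 : 4 * (m * n) * (u * (N + 1) + 3 * u) ≤ 4 * (m * n) * G := mul_le_mul_of_nonneg_left (by linarith) (by positivity)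
      have h2 : 0 < u * m * n := mul_pos (mul_pos (by linarith) hm0) hn0
      linarith
    linarith

/-- **ALONG, `σ = −1`** ((ζ′) twin of `RootArith.along_neg`; mirror: `800Qu − 10Qu + 1 ≤ −LHI`, `−LLO ≤ 800Qu + 10Qu − 1`).
[cite: KozmaNitzan2024, §4 Lemma 11 (p. 22)] -/
theorem along_negA {A Q u m n su v ℓ W RA q N Λ : ℤ} (hA : 2 ≤ A) (hQ : 1 ≤ Q) (hu : 1 ≤ u) (hn : 1 ≤ n) (hm : n * (ℓ - 1) < m)
    (hsu : n ≤ su) (hsu' : su ≤ 11 * n) (hv : |v| ≤ n) (hW : su * W ≤ n * ℓ + su) (hW0 : 0 ≤ W) (hRA : 0 ≤ RA)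
    (hRAn : 2000 * Q * (RA + 2) ≤ n) (hRAℓ : 22000 * Q * (RA + 2) ≤ ℓ) (hq : 0 ≤ q) (hq' : 4 * q ≤ n) (hN : 0 ≤ N) (hN' : N + 1 ≤ 1000 * Q)
    (hcen : |(A * u * (A * Λ) + A ^ 2 * m / 2) / (A ^ 2 * m) - u * (N + 1) + 800 * Q * u| ≤ u) :
    800 * Q * u - 10 * Q * u + 1 ≤ -((A * u * (A * Λ) + A ^ 2 * m / 2) / (A ^ 2 * m) +
        (A * u * (A * (m * (max ((-1) * ((N + 1) * n - q - (N + 1) * RA)) ((-1) * ((N + 1) * n + q + (N + 1) * RA))) -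
          min (v * (su * (min ((-1) * (-(W + (N + 1) * RA))) ((-1) * (W + (N + 1) * RA)) - 1))) (v * (su * (max ((-1) * (-(W + (N + 1) * RA))) ((-1) * (W + (N + 1) * RA))) + su - 1))) / n)) /
          (A ^ 2 * m) + 1) ∧
      -((A * u * (A * Λ) + A ^ 2 * m / 2) / (A ^ 2 * m) +
        (A * u * (A * (m * (min ((-1) * ((N + 1) * n - q - (N + 1) * RA)) ((-1) * ((N + 1) * n + q + (N + 1) * RA))) -
          max (v * (su * (min ((-1) * (-(W + (N + 1) * RA))) ((-1) * (W + (N + 1) * RA)) - 1))) (v * (su * (max ((-1) * (-(W + (N + 1) * RA))) ((-1) * (W + (N + 1) * RA))) + su - 1))) / n)) /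
          (A ^ 2 * m)) ≤ 800 * Q * u + 10 * Q * u - 1 := by
  have hn0 : 0 < n := by linarith
  have hu0 : 0 ≤ u := by linarith
  have hQRA : 0 ≤ Q * RA := mul_nonneg (by linarith) hRA
  have hℓ1 : 47 ≤ ℓ := by linarith
  have hm0 : 0 < m := by have : 0 ≤ n * (ℓ - 1) := mul_nonneg hn0.le (by linarith); linarith
  have hm2 : 2 ≤ m := by have : (1 : ℤ) * 46 ≤ n * (ℓ - 1) := mul_le_mul hn (by linarith) (by norm_num) hn0.le; linarith
  have hQu : u ≤ Q * u := le_mul_of_one_le_left hu0 hQ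
  set Fc := (A * u * (A * Λ) + A ^ 2 * m / 2) / (A ^ 2 * m)
  set L := W + (N + 1) * RA with hLdef
  have hNR : 0 ≤ (N + 1) * RA := mul_nonneg (by linarith) hRA
  have hL0 : 0 ≤ L := by rw [hLdef]; linarith
  have hNR' : (N + 1) * RA ≤ 1000 * Q * RA := mul_le_mul_of_nonneg_right hN' hRA
  have hqr : 4 * (q + (N + 1) * RA) ≤ 3 * n := by linarith
  simp only [neg_mul, one_mul, neg_neg]
  rw [max_eq_left (by linarith : -((N + 1) * n + q + (N + 1) * RA) ≤ -((N + 1) * n - q - (N + 1) * RA)),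
    min_eq_right (by linarith : -((N + 1) * n + q + (N + 1) * RA) ≤ -((N + 1) * n - q - (N + 1) * RA)),
    min_eq_right (by linarith : -L ≤ L), max_eq_left (by linarith : -L ≤ L)]
  obtain ⟨hBmax, hBmin⟩ := B_bounds (v := v) (su := su) (L := L) (by linarith) hL0
  set Bmax := max (v * (su * (-L - 1))) (v * (su * L + su - 1))
  set Bmin := min (v * (su * (-L - 1))) (v * (su * L + su - 1))
  have hℓ0 : 0 ≤ ℓ := by linarith
  have hsu0 : 0 ≤ su := by linarith
  have hsuL : su * (L + 1) ≤ n * ℓ + 22 * n + 11000 * Q * n * RA := by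
    have h1 : su * ((N + 1) * RA) ≤ (11 * n) * (1000 * Q * RA) := mul_le_mul hsu' hNR' hNR (by positivity)
    rw [hLdef]; linarith
  have hvs : |v| * (su * (L + 1)) ≤ n * (n * ℓ + 22 * n + 11000 * Q * n * RA) :=
    mul_le_mul hv hsuL (by positivity) (by positivity)
  have h3m : 2 * (n * (n * ℓ + 22 * n + 11000 * Q * n * RA)) ≤ 3 * m * n := by
    have hℓ' : 47 + 22000 * Q * RA ≤ ℓ := by linarith
    have h1 := mul_le_mul_of_nonneg_left hℓ' hn0.le
    have h2X : 2 * (n * ℓ + 22 * n + 11000 * Q * n * RA) ≤ 3 * m := by linarith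
    have h3 := mul_le_mul_of_nonneg_left h2X hn0.le
    linarith
  have hBx : 2 * |Bmax| ≤ 3 * m * n := by linarith
  have hBn : 2 * |Bmin| ≤ 3 * m * n := by linarith
  have hcen' := abs_le.1 hcen
  constructor
  · obtain ⟨g1, -⟩ := incr_boundsA (A := A) (u := u) (m := m) (n := n) (X := m * -((N + 1) * n - q - (N + 1) * RA) - Bmin) (by linarith) hu0 hm0 hn0
    set G := A * u * (A * (m * -((N + 1) * n - q - (N + 1) * RA) - Bmin) / n) / (A ^ 2 * m)
    have e1 : u * (4 * (m * -((N + 1) * n - q - (N + 1) * RA))) ≤ u * (-(4 * m * n * (N + 1)) + 3 * m * n) := by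
      refine mul_le_mul_of_nonneg_left ?_ hu0
      have := mul_le_mul_of_nonneg_left hqr hm0.le
      linarith
    have e2 : 2 * (u * (-Bmin)) ≤ 3 * u * m * n := by
      have h1 : u * (-Bmin) ≤ u * |Bmin| := mul_le_mul_of_nonneg_left (neg_le_abs _) hu0
      have h2 := mul_le_mul_of_nonneg_left hBn hu0
      linarith
    have key : 4 * (m * n * G) ≤ -(4 * u * m * n * (N + 1)) + 9 * u * m * n := by linarith
    have hX : G ≤ -(u * (N + 1)) + 3 * u - 1 := by
      by_contra hc
      push Not at hc
      have h1 : 4 * (m * n) * (-(u * (N + 1)) + 3 * u) ≤ 4 * (m * n) * G := mul_le_mul_of_nonneg_left (by linarith) (by positivity)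
      have h2 : 0 < u * m * n := mul_pos (mul_pos (by linarith) hm0) hn0
      linarith
    linarith
  · obtain ⟨-, g2⟩ := incr_boundsA (A := A) (u := u) (m := m) (n := n) (X := m * -((N + 1) * n + q + (N + 1) * RA) - Bmax) (by linarith) hu0 hm0 hn0
    set G := A * u * (A * (m * -((N + 1) * n + q + (N + 1) * RA) - Bmax) / n) / (A ^ 2 * m)
    have e1 : u * (4 * (m * -((N + 1) * n + q + (N + 1) * RA))) ≥ u * (-(4 * m * n * (N + 1)) - 3 * m * n) := by
      refine mul_le_mul_of_nonneg_left ?_ hu0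
      have := mul_le_mul_of_nonneg_left hqr hm0.le
      linarith
    have e2 : 2 * (u * Bmax) ≤ 3 * u * m * n := by
      have h1 : u * Bmax ≤ u * |Bmax| := mul_le_mul_of_nonneg_left (le_abs_self _) hu0
      have h2 := mul_le_mul_of_nonneg_left hBx hu0
      linarith
    have key : 4 * (m * n * (G + u * (N + 1) + 3 * u + 1)) ≥ u * n * (3 * m - 4) := by linarith
    have hX : 0 ≤ G + u * (N + 1) + 3 * u + 1 := by
      by_contra hc
      push Not at hc
      have h1 : 4 * (m * n) * (G + u * (N + 1) + 3 * u + 1) ≤ 4 * (m * n) * (-1) := mul_le_mul_of_nonneg_left (by linarith) (by positivity)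
      have h2 : 0 ≤ u * n * (3 * m - 4) := mul_nonneg (mul_nonneg hu0 hn0.le) (by linarith)
      have hmn : 0 < m * n := mul_pos hm0 hn0
      linarith
    linarith

/-- **ACROSS (last core), either `σ`** ((ζ′) twin of `RootArith.trans_last`): `−(10Qu − 1) ≤ LLO₁`, `LHI₁ ≤ 10Qu − 1` (`u = s₁`, `|Λ₁| ≤ 2m`).
[cite: KozmaNitzan2024, §4 Lemma 11 (p. 22)] -/
theorem trans_lastA {A Q u m n su ℓ W RA N Λ σ : ℤ} (hA : 2 ≤ A) (hAe : 2 ∣ A) (hQ : 1 ≤ Q) (hu : 1 ≤ u) (hn : 1 ≤ n) (hm : n * (ℓ - 1) < m)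
    (hsu : n ≤ su) (hsu' : su ≤ 11 * n) (hW : su * W ≤ n * ℓ + su) (hW0 : 0 ≤ W) (hRA : 0 ≤ RA) (hRAℓ : 22000 * Q * (RA + 2) ≤ ℓ)
    (hN : 0 ≤ N) (hN' : N + 1 ≤ 1000 * Q) (hσ : σ = 1 ∨ σ = -1) (hΛ : |Λ| ≤ 2 * m) :
    -(10 * Q * u - 1) ≤ (A * u * (A * Λ) + A ^ 2 * m / 2) / (A ^ 2 * m) +
        (A * u * (A * (su * (min (σ * (-(W + (N + 1) * RA))) (σ * (W + (N + 1) * RA)) - 1)))) / (A ^ 2 * m) ∧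
      (A * u * (A * Λ) + A ^ 2 * m / 2) / (A ^ 2 * m) +
        (A * u * (A * (su * (max (σ * (-(W + (N + 1) * RA))) (σ * (W + (N + 1) * RA))) + su - 1))) / (A ^ 2 * m) + 1 ≤ 10 * Q * u - 1 := by
  have hn0 : 0 < n := by linarith
  have hu0 : 0 ≤ u := by linarith
  have hA0 : 0 < A := by linarith
  have hQRA : 0 ≤ Q * RA := mul_nonneg (by linarith) hRA
  have hℓ1 : 47 ≤ ℓ := by linarith
  have hm0 : 0 < m := by have : 0 ≤ n * (ℓ - 1) := mul_nonneg hn0.le (by linarith); linarith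
  have hQu : u ≤ Q * u := le_mul_of_one_le_left hu0 hQ
  set L := W + (N + 1) * RA with hLdef
  have hNR : 0 ≤ (N + 1) * RA := mul_nonneg (by linarith) hRA
  have hL0 : 0 ≤ L := by rw [hLdef]; linarith
  have hNR' : (N + 1) * RA ≤ 1000 * Q * RA := mul_le_mul_of_nonneg_right hN' hRA
  have hmin : min (σ * -L) (σ * L) = -L := by
    rcases hσ with rfl | rfl
    · simp only [one_mul]; exact min_eq_left (by linarith)
    · simp only [neg_mul, one_mul, neg_neg]; exact min_eq_right (by linarith)
  have hmax : max (σ * -L) (σ * L) = L := by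
    rcases hσ with rfl | rfl
    · simp only [one_mul]; exact max_eq_right (by linarith)
    · simp only [neg_mul, one_mul, neg_neg]; exact max_eq_left (by linarith)
  rw [hmin, hmax]
  obtain ⟨f1, f2⟩ := coarse_boundsA (u := u) (Λ := Λ) hA0 hAe hm0
  set F := (A * u * (A * Λ) + A ^ 2 * m / 2) / (A ^ 2 * m)
  obtain ⟨hΛ1, hΛ2⟩ := abs_le.1 hΛ
  have huΛlo : u * (-(2 * m)) ≤ u * Λ := mul_le_mul_of_nonneg_left hΛ1 hu0
  have huΛhi : u * Λ ≤ u * (2 * m) := mul_le_mul_of_nonneg_left hΛ2 hu0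
  have hF : -2 * u ≤ F ∧ F ≤ 2 * u := by
    constructor
    · by_contra hc; push Not at hc
      have h1 : 2 * m * F ≤ 2 * m * (-2 * u - 1) := mul_le_mul_of_nonneg_left (by linarith) (by linarith)
      linarith
    · by_contra hc; push Not at hc
      have h1 : 2 * m * (2 * u + 1) ≤ 2 * m * F := mul_le_mul_of_nonneg_left (by linarith) (by linarith)
      linarith
  have hℓ0 : 0 ≤ ℓ := by linarith
  have hsu0 : 0 ≤ su := by linarith
  have hsuL : su * (L + 1) ≤ n * ℓ + 22 * n + 11000 * Q * n * RA := by
    have h1 : su * ((N + 1) * RA) ≤ (11 * n) * (1000 * Q * RA) := mul_le_mul hsu' hNR' hNR (by positivity)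
    rw [hLdef]; linarith
  have h2X : 2 * (n * ℓ + 22 * n + 11000 * Q * n * RA) ≤ 3 * m := by
    have hℓ' : 47 + 22000 * Q * RA ≤ ℓ := by linarith
    have h1 := mul_le_mul_of_nonneg_left hℓ' hn0.le
    linarith
  have hsL : 2 * (su * (L + 1)) ≤ 3 * m := by linarith
  constructor
  · obtain ⟨-, t2⟩ := trans_boundsA (u := u) (m := m) (Y := su * (-L - 1)) hA0 hm0
    set H := A * u * (A * (su * (-L - 1))) / (A ^ 2 * m)
    have e : 2 * (u * (su * (-L - 1))) ≥ -(3 * u * m) := by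
      have := mul_le_mul_of_nonneg_left hsL hu0; linarith
    have hX : -2 * u - 1 ≤ H := by
      by_contra hc; push Not at hc
      have h1 : m * H ≤ m * (-2 * u - 2) := mul_le_mul_of_nonneg_left (by linarith) hm0.le
      linarith
    linarith
  · obtain ⟨t1, -⟩ := trans_boundsA (u := u) (m := m) (Y := su * L + su - 1) hA0 hm0
    set H := A * u * (A * (su * L + su - 1)) / (A ^ 2 * m)
    have e : 2 * (u * (su * L + su - 1)) ≤ 3 * u * m := by
      have := mul_le_mul_of_nonneg_left hsL hu0; linarith
    have hX : H ≤ 2 * u := by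
      by_contra hc; push Not at hc
      have h1 : m * (2 * u + 1) ≤ m * H := mul_le_mul_of_nonneg_left (by linarith) hm0.le
      linarith
    linarith

end RootArithA

end NegB

end PlanarSkeletonNeg

end Summit.CriticalPhenomena.PercolationContinuityZ3.Theorems.Transplant
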